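import Literature.Analysis.FluidPDE.RadialQuotientSobolev
import Literature.Analysis.Calculus.IteratedFDerivParametricIntegral
import HarnessLib

/-!
# Iterated derivatives of the radial quotients: formulas and `L²` bounds

Analysis/FluidPDE support file (all results proved; no definitions, no named facts) on the
decomposition path of the named fact
`Literature.Analysis.FluidPDE.LeiZhang2017_smallSwirl_regularity` (Lei–Zhang 2017, Thm. 1.4).
The quotients `radDerivQuot S = ∫₀¹ ∂₀∂₀S(scaleFst τ ·) dτ` and
`radQuot S = ∫₀¹ s · radDerivQuot S (scaleH s ·) ds` (`AxisymRadialQuotient.lean`) are interval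
integrals of a jointly smooth integrand; this file differentiates under the integral sign to all
orders and bounds the derivatives by ray averages of the derivatives of `W = ∂₀∂₀S`:

* `contDiff_uncurry_iteratedFDeriv_slice`, `iteratedFDeriv_intervalIntegral_eq` — for a
  jointly smooth `F : E → ℝ → G`, `Dⁿ_x ∫ₐᵇ F(x, t) dt = ∫ₐᵇ Dⁿ_x F(x, t) dt` (induction on `n`
  through the first-order theorem `Calculus.fderiv_intervalIntegral_eq_partialFDerivFst`);
* `norm_iteratedFDeriv_radDerivQuot_le` — `‖Dⁿ(radDerivQuot S)(y)‖ ≤ ∫₀¹ ‖DⁿW(scaleFst τ y)‖ dτ`;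
* `norm_iteratedFDeriv_radQuot_le` —
  `‖Dⁿ(radQuot S)(x)‖ ≤ ∫₀¹ s ∫₀¹ ‖DⁿW(scaleFst τ (scaleH s x))‖ dτ ds`;
* `lintegral_sq_iteratedFDeriv_radQuot_le` — hence `∫ ‖Dⁿ(radQuot S)‖² ≤ 4 ∫ ‖DⁿW‖²`, and
  `lintegral_sq_iteratedFDeriv_radDerivQuot_le` — `∫ ‖Dⁿ(radDerivQuot S)‖² ≤ 4 ∫ ‖DⁿW‖²`
  (the ray-average bounds of `RadialQuotientSobolev.lean`), with the sup bounds
  `‖Dⁿ(radQuot S)‖ ≤ B/2`, `‖Dⁿ(radDerivQuot S)‖ ≤ B` when `‖DⁿW‖ ≤ B`.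

All statements are folklore calculus.

## Mathlib / tree search

Tree: `Calculus.fderiv_intervalIntegral_eq_partialFDerivFst`, `Calculus.fderiv_eq_partialFDerivFst`,
`Calculus.continuous_uncurry_partialFDerivFst` (`Calculus/HadamardLemma`); the ray-average
bounds (`RadialQuotientSobolev`). Mathlib: `ContDiff.fderiv` (parametric derivatives are
smooth), `iteratedFDeriv_succ_eq_comp_left`, `ContinuousLinearMap.iteratedFDeriv_comp_right`,
`ContinuousLinearMap.intervalIntegral_comp_comm`,
`ContinuousMultilinearMap.norm_compContinuousLinearMap_le`.

## References

* Z. Lei, Q. S. Zhang, Pacific J. Math. 289 (2017) = arXiv:1505.02628, §4. [LeiZhang2017]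
* J. Dieudonné, *Foundations of Modern Analysis* (1960), (8.11.2). [folklore]
-/

noncomputable section

open MeasureTheory Set Function Filter Topology
open scoped ENNReal NNReal ContDiff

namespace Literature.Analysis.FluidPDE

/-! ### Iterated differentiation under the interval integral for jointly smooth integrands -/

section IteratedIntervalIntegral

variable {E : Type*} [NormedAddCommGroup E] [NormedSpace ℝ E]
variable {G : Type*} [NormedAddCommGroup G] [NormedSpace ℝ G] [CompleteSpace G]

omit [CompleteSpace G] in
/-- **Partial iterated derivatives of a jointly smooth family are jointly smooth**:
if `(x, t) ↦ F x t` is `C^∞` then so is `(x, t) ↦ Dⁿ_x F(·, t)(x)` for every `n` — indeed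
`Dⁿ_x F(·,t)(x) = Dⁿ(uncurry F)(x,t) ∘ (inl, …, inl)`. [folklore] -/
theorem contDiff_uncurry_iteratedFDeriv_slice {F : E → ℝ → G} (hF : ContDiff ℝ ∞ (uncurry F))
    (n : ℕ) : ContDiff ℝ ∞ (uncurry fun (x : E) (t : ℝ) => iteratedFDeriv ℝ n (fun y => F y t) x) := by
  have hrepr : (uncurry fun (x : E) (t : ℝ) => iteratedFDeriv ℝ n (fun y => F y t) x) =
      fun p : E × ℝ => (iteratedFDeriv ℝ n (uncurry F) p).compContinuousLinearMap
        fun _ => ContinuousLinearMap.inl ℝ E ℝ := by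
    funext p
    obtain ⟨x, t⟩ := p
    have hfun : (fun y => F y t) =
        fun y => uncurry F (ContinuousLinearMap.inl ℝ E ℝ y + ((0 : E), t)) := by
      funext y; simp
    simp only [uncurry_apply_pair]
    rw [hfun, Calculus.iteratedFDeriv_comp_affine hF (ContinuousLinearMap.inl ℝ E ℝ) ((0 : E), t)
      (by exact_mod_cast (le_top : (n : ℕ∞) ≤ ⊤)) x]
    congr 2
    simp
  rw [hrepr]
  exact (ContinuousMultilinearMap.compContinuousLinearMapL fun _ : Fin n =>
    ContinuousLinearMap.inl ℝ E ℝ).contDiff.comp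
      (hF.iteratedFDeriv_right (m := ∞) (by exact_mod_cast (le_top : (⊤ : ℕ∞) + n ≤ ⊤)))

/-- **Iterated differentiation under the interval integral** for a jointly smooth integrand:
`Dⁿ (x ↦ ∫ₐᵇ F(x, t) dt) = x ↦ ∫ₐᵇ Dⁿ_x F(·, t)(x) dt` (Dieudonné (8.11.2), iterated).
[folklore] -/
theorem iteratedFDeriv_intervalIntegral_eq {F : E → ℝ → G} (hF : ContDiff ℝ ∞ (uncurry F))
    (a b : ℝ) (n : ℕ) :
    iteratedFDeriv ℝ n (fun x => ∫ t in a..b, F x t) =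
      fun x => ∫ t in a..b, iteratedFDeriv ℝ n (fun y => F y t) x := by
  induction n with
  | zero =>
    funext x
    rw [iteratedFDeriv_zero_eq_comp, comp_apply]
    simp_rw [iteratedFDeriv_zero_eq_comp, comp_apply]
    exact ((continuousMultilinearCurryFin0 ℝ E G).symm.toLinearIsometry.intervalIntegral_comp_comm
      (fun t => F x t)).symm
  | succ n ih =>
    funext x
    have hΦ := contDiff_uncurry_iteratedFDeriv_slice hF n
    rw [iteratedFDeriv_succ_eq_comp_left, comp_apply, ih,
      Calculus.fderiv_intervalIntegral_eq_partialFDerivFst hΦ (by simp) a b]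
    simp_rw [iteratedFDeriv_succ_eq_comp_left, comp_apply]
    have key : ∀ t : ℝ, fderiv ℝ (iteratedFDeriv ℝ n fun y => F y t) x =
        Calculus.partialFDerivFst (fun (x : E) (t : ℝ) => iteratedFDeriv ℝ n (fun y => F y t) x)
          x t := fun t => Calculus.fderiv_eq_partialFDerivFst hΦ (by simp) x t
    simp_rw [key]
    have hint : IntervalIntegrable (fun t => Calculus.partialFDerivFst
        (fun (x : E) (t : ℝ) => iteratedFDeriv ℝ n (fun y => F y t) x) x t) volume a b :=
      ((Calculus.continuous_uncurry_partialFDerivFst hΦ (by simp)).comp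
        (Continuous.prodMk_right x)).intervalIntegrable _ _
    exact (ContinuousLinearMap.intervalIntegral_comp_comm (𝕜 := ℝ)
      ((continuousMultilinearCurryLeftEquiv ℝ (fun _ : Fin (n + 1) => E)
        G).symm.toContinuousLinearEquiv : (E →L[ℝ] ContinuousMultilinearMap ℝ (fun _ : Fin n => E) G)
          →L[ℝ] ContinuousMultilinearMap ℝ (fun _ : Fin (n + 1) => E) G) hint).symm

/-- Norm bound: `‖Dⁿ(x ↦ ∫ₐᵇ F(x,t) dt)(x)‖ ≤ ∫ₐᵇ ‖Dⁿ_x F(·,t)(x)‖ dt` for `a ≤ b`. [folklore] -/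
theorem norm_iteratedFDeriv_intervalIntegral_le {F : E → ℝ → G} (hF : ContDiff ℝ ∞ (uncurry F))
    {a b : ℝ} (hab : a ≤ b) (n : ℕ) (x : E) :
    ‖iteratedFDeriv ℝ n (fun x => ∫ t in a..b, F x t) x‖ ≤
      ∫ t in a..b, ‖iteratedFDeriv ℝ n (fun y => F y t) x‖ := by
  rw [iteratedFDeriv_intervalIntegral_eq hF a b n]
  exact intervalIntegral.norm_integral_le_integral_norm hab

end IteratedIntervalIntegral


/-! ### Derivatives of `radDerivQuot S` and `radQuot S` as ray averages -/

section RadialQuotients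

variable {S : EuclideanSpace ℝ (Fin 3) → ℝ}

/-- Precomposition with a linear contraction does not increase iterated derivatives:
`‖Dⁿ(Φ ∘ L)(x)‖ ≤ ‖DⁿΦ(Lx)‖` for `‖L‖ ≤ 1`. [folklore] -/
theorem norm_iteratedFDeriv_comp_clm_le_of_norm_le_one {Φ : EuclideanSpace ℝ (Fin 3) → ℝ} (hΦ : ContDiff ℝ ∞ Φ)
    {L : EuclideanSpace ℝ (Fin 3) →L[ℝ] EuclideanSpace ℝ (Fin 3)} (hL : ‖L‖ ≤ 1) (n : ℕ)
    (x : EuclideanSpace ℝ (Fin 3)) :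
    ‖iteratedFDeriv ℝ n (fun y => Φ (L y)) x‖ ≤ ‖iteratedFDeriv ℝ n Φ (L x)‖ := by
  have h := Calculus.norm_iteratedFDeriv_comp_affine_le_of_norm_le_one hΦ hL 0
    (n := n) (by exact_mod_cast (le_top : (n : ℕ∞) ≤ ⊤)) x
  simpa only [add_zero] using h

/-- **Derivatives of the radial derivative quotient**: for `S ∈ C^∞`, with
`W = ∂₀∂₀S` (`W z = D(∂₀S)(z) e₀`),
`Dⁿ(radDerivQuot S)(y) = ∫₀¹ Dⁿ[W ∘ scaleFst τ](y) dτ` and hence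
`‖Dⁿ(radDerivQuot S)(y)‖ ≤ ∫₀¹ ‖DⁿW(scaleFst τ y)‖ dτ`. [folklore] -/
theorem norm_iteratedFDeriv_radDerivQuot_le (hS : ContDiff ℝ ∞ S) (n : ℕ)
    (y : EuclideanSpace ℝ (Fin 3)) :
    ‖iteratedFDeriv ℝ n (radDerivQuot S) y‖ ≤
      ∫ τ in (0 : ℝ)..1, ‖iteratedFDeriv ℝ n
        (fun z => fderiv ℝ (fun z' => fderiv ℝ S z' (EuclideanSpace.single 0 1)) z
          (EuclideanSpace.single 0 1)) (scaleFst τ y)‖ := by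
  set W : EuclideanSpace ℝ (Fin 3) → ℝ := fun z =>
    fderiv ℝ (fun z' => fderiv ℝ S z' (EuclideanSpace.single 0 1)) z (EuclideanSpace.single 0 1)
    with hW
  have hS1 : ContDiff ℝ ((⊤ : ℕ∞) + 1 : ℕ∞) S := by simpa using hS
  have hdS : ContDiff ℝ (⊤ : ℕ∞) fun z' => fderiv ℝ S z' (EuclideanSpace.single 0 1) :=
    contDiff_fderiv_apply_const_succ (n := (⊤ : ℕ∞)) hS1 _
  have hdS1 : ContDiff ℝ ((⊤ : ℕ∞) + 1 : ℕ∞) fun z' => fderiv ℝ S z' (EuclideanSpace.single 0 1) := by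
    simpa using hdS
  have hW' : ContDiff ℝ ∞ W := contDiff_fderiv_apply_const_succ (n := (⊤ : ℕ∞)) hdS1 _
  -- `radDerivQuot S = ∫₀¹ W(scaleFst τ ·) dτ`, a jointly smooth family
  have hrepr : radDerivQuot S = fun y => ∫ τ in (0 : ℝ)..1, W (scaleFst τ y) := rfl
  have hF : ContDiff ℝ ∞ (uncurry fun (y : EuclideanSpace ℝ (Fin 3)) (τ : ℝ) => W (scaleFst τ y)) :=
    hW'.comp contDiff_scaleFst_uncurry
  rw [hrepr]
  refine (norm_iteratedFDeriv_intervalIntegral_le hF zero_le_one n y).trans ?_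
  refine intervalIntegral.integral_mono_on zero_le_one ?_ ?_ fun τ hτ => ?_
  · exact ((contDiff_uncurry_iteratedFDeriv_slice hF n).continuous.comp
      (Continuous.prodMk_right y)).norm.intervalIntegrable _ _
  · exact ((hW'.continuous_iteratedFDeriv (m := n) (by exact_mod_cast (le_top : (n : ℕ∞) ≤ ⊤))).comp
      ((contDiff_scaleFst_uncurry (n := 0)).continuous.comp
        (continuous_const.prodMk continuous_id))).norm.intervalIntegrable _ _
  · have hfun : (fun z => W (scaleFst τ z)) = fun z => W (scaleFstL τ z) := by
      funext z; rw [scaleFstL_apply]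
    rw [hfun]
    have h := norm_iteratedFDeriv_comp_clm_le_of_norm_le_one hW' (norm_scaleFstL_le hτ) n y
    rwa [scaleFstL_apply] at h

/-- **Derivatives of the radial quotient**: for `S ∈ C^∞`,
`‖Dⁿ(radQuot S)(x)‖ ≤ ∫₀¹ s ‖Dⁿ(radDerivQuot S)(scaleH s x)‖ ds`. [folklore] -/
theorem norm_iteratedFDeriv_radQuot_le (hS : ContDiff ℝ ∞ S) (n : ℕ)
    (x : EuclideanSpace ℝ (Fin 3)) :
    ‖iteratedFDeriv ℝ n (radQuot S) x‖ ≤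
      ∫ s in (0 : ℝ)..1, s * ‖iteratedFDeriv ℝ n (radDerivQuot S) (scaleH s x)‖ := by
  have hS2 : ContDiff ℝ ((⊤ : ℕ∞) + 1 + 1 : ℕ∞) S := by simpa using hS
  have hq : ContDiff ℝ ∞ (radDerivQuot S) := contDiff_radDerivQuot (n := (⊤ : ℕ∞)) hS2
  have hrepr : radQuot S = fun x => ∫ s in (0 : ℝ)..1, s * radDerivQuot S (scaleH s x) := rfl
  have hF : ContDiff ℝ ∞ (uncurry fun (x : EuclideanSpace ℝ (Fin 3)) (s : ℝ) =>
      s * radDerivQuot S (scaleH s x)) :=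
    contDiff_snd.mul (hq.comp contDiff_scaleH_uncurry)
  rw [hrepr]
  refine (norm_iteratedFDeriv_intervalIntegral_le hF zero_le_one n x).trans ?_
  refine intervalIntegral.integral_mono_on zero_le_one ?_ ?_ fun s hs => ?_
  · exact ((contDiff_uncurry_iteratedFDeriv_slice hF n).continuous.comp
      (Continuous.prodMk_right x)).norm.intervalIntegrable _ _
  · exact (continuous_id.mul ((hq.continuous_iteratedFDeriv (m := n)
      (by exact_mod_cast (le_top : (n : ℕ∞) ≤ ⊤))).comp ((contDiff_scaleH_uncurry (n := 0)).continuous.comp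
        (continuous_const.prodMk continuous_id))).norm).intervalIntegrable _ _
  · -- `Dⁿ[s · q ∘ scaleH s] = s • Dⁿ[q ∘ scaleHL s]`, of norm `≤ s ‖Dⁿq(scaleH s x)‖`
    have hfun : (fun z => s * radDerivQuot S (scaleH s z)) = fun z => s • radDerivQuot S (scaleHL s z) := by
      funext z; rw [scaleHL_apply, smul_eq_mul]
    rw [hfun, iteratedFDeriv_const_smul_apply' , norm_smul, Real.norm_eq_abs, abs_of_nonneg hs.1]
    · refine mul_le_mul_of_nonneg_left ?_ hs.1
      have h := norm_iteratedFDeriv_comp_clm_le_of_norm_le_one hq (norm_scaleHL_le hs) n x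
      rwa [scaleHL_apply] at h
    · exact ((hq.of_le (by exact_mod_cast (le_top : (n : ℕ∞) ≤ ⊤))).comp
        (scaleHL s).contDiff).contDiffAt


/-! #### `L²` and sup bounds -/

/-- For a continuous `f ≥ 0` on `(0, 1)`: `ofReal (∫₀¹ f) = ∫⁻_{(0,1)} ofReal f`. [folklore] -/
theorem ofReal_intervalIntegral_eq_lintegral_Ioo {f : ℝ → ℝ} (hf : Continuous f)
    (hnn : ∀ s ∈ Ioo (0 : ℝ) 1, 0 ≤ f s) :
    ENNReal.ofReal (∫ s in (0 : ℝ)..1, f s) = ∫⁻ s in Ioo (0 : ℝ) 1, ENNReal.ofReal (f s) := by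
  rw [intervalIntegral.integral_of_le zero_le_one, integral_Ioc_eq_integral_Ioo,
    ← ofReal_integral_eq_lintegral_ofReal (hf.integrableOn_Icc.mono_set Ioo_subset_Icc_self)]
  exact (ae_restrict_iff' measurableSet_Ioo).2 (Eventually.of_forall hnn)

/-- `‖Dⁿ(radDerivQuot S)(y)‖ₑ ≤ ∫⁻₀¹ ‖DⁿW(scaleFst τ y)‖ₑ dτ` (`W = ∂₀∂₀S`). [folklore] -/
theorem enorm_iteratedFDeriv_radDerivQuot_le (hS : ContDiff ℝ ∞ S) (n : ℕ)
    (y : EuclideanSpace ℝ (Fin 3)) :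
    ‖iteratedFDeriv ℝ n (radDerivQuot S) y‖ₑ ≤
      ∫⁻ τ in Ioo (0 : ℝ) 1, ‖iteratedFDeriv ℝ n
        (fun z => fderiv ℝ (fun z' => fderiv ℝ S z' (EuclideanSpace.single 0 1)) z
          (EuclideanSpace.single 0 1)) (scaleFst τ y)‖ₑ := by
  set W : EuclideanSpace ℝ (Fin 3) → ℝ := fun z =>
    fderiv ℝ (fun z' => fderiv ℝ S z' (EuclideanSpace.single 0 1)) z (EuclideanSpace.single 0 1)
    with hW
  have hS1 : ContDiff ℝ ((⊤ : ℕ∞) + 1 : ℕ∞) S := by simpa using hS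
  have hdS : ContDiff ℝ (⊤ : ℕ∞) fun z' => fderiv ℝ S z' (EuclideanSpace.single 0 1) :=
    contDiff_fderiv_apply_const_succ (n := (⊤ : ℕ∞)) hS1 _
  have hdS1 : ContDiff ℝ ((⊤ : ℕ∞) + 1 : ℕ∞) fun z' => fderiv ℝ S z' (EuclideanSpace.single 0 1) := by
    simpa using hdS
  have hW' : ContDiff ℝ ∞ W := contDiff_fderiv_apply_const_succ (n := (⊤ : ℕ∞)) hdS1 _
  have hcont : Continuous fun τ : ℝ => ‖iteratedFDeriv ℝ n W (scaleFst τ y)‖ :=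
    ((hW'.continuous_iteratedFDeriv (m := n) (by exact_mod_cast (le_top : (n : ℕ∞) ≤ ⊤))).comp
      ((contDiff_scaleFst_uncurry (n := 0)).continuous.comp
        (continuous_const.prodMk continuous_id))).norm
  rw [← ofReal_norm]
  refine (ENNReal.ofReal_le_ofReal (norm_iteratedFDeriv_radDerivQuot_le hS n y)).trans (le_of_eq ?_)
  rw [ofReal_intervalIntegral_eq_lintegral_Ioo hcont fun τ _ => norm_nonneg _]
  exact lintegral_congr fun τ => ofReal_norm _

/-- `‖Dⁿ(radQuot S)(x)‖ₑ ≤ ∫⁻₀¹ s ‖Dⁿ(radDerivQuot S)(scaleH s x)‖ₑ ds`. [folklore] -/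
theorem enorm_iteratedFDeriv_radQuot_le (hS : ContDiff ℝ ∞ S) (n : ℕ)
    (x : EuclideanSpace ℝ (Fin 3)) :
    ‖iteratedFDeriv ℝ n (radQuot S) x‖ₑ ≤ ∫⁻ s in Ioo (0 : ℝ) 1,
      ENNReal.ofReal s * ‖iteratedFDeriv ℝ n (radDerivQuot S) (scaleH s x)‖ₑ := by
  have hS2 : ContDiff ℝ ((⊤ : ℕ∞) + 1 + 1 : ℕ∞) S := by simpa using hS
  have hq : ContDiff ℝ ∞ (radDerivQuot S) := contDiff_radDerivQuot (n := (⊤ : ℕ∞)) hS2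
  have hcont : Continuous fun s : ℝ => s * ‖iteratedFDeriv ℝ n (radDerivQuot S) (scaleH s x)‖ :=
    continuous_id.mul ((hq.continuous_iteratedFDeriv (m := n)
      (by exact_mod_cast (le_top : (n : ℕ∞) ≤ ⊤))).comp ((contDiff_scaleH_uncurry (n := 0)).continuous.comp
        (continuous_const.prodMk continuous_id))).norm
  rw [← ofReal_norm]
  refine (ENNReal.ofReal_le_ofReal (norm_iteratedFDeriv_radQuot_le hS n x)).trans (le_of_eq ?_)
  rw [ofReal_intervalIntegral_eq_lintegral_Ioo hcont fun s hs =>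
    mul_nonneg hs.1.le (norm_nonneg _)]
  refine setLIntegral_congr_fun measurableSet_Ioo fun s hs => ?_
  rw [ENNReal.ofReal_mul hs.1.le, ofReal_norm]

/-- **`∫ ‖Dⁿ(radDerivQuot S)‖² ≤ 4 ∫ ‖Dⁿ(∂₀∂₀S)‖²`** for `S ∈ C^∞`. [folklore] -/
theorem lintegral_sq_iteratedFDeriv_radDerivQuot_le (hS : ContDiff ℝ ∞ S) (n : ℕ) :
    ∫⁻ y, ‖iteratedFDeriv ℝ n (radDerivQuot S) y‖ₑ ^ 2 ≤
      4 * ∫⁻ y, ‖iteratedFDeriv ℝ n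
        (fun z => fderiv ℝ (fun z' => fderiv ℝ S z' (EuclideanSpace.single 0 1)) z
          (EuclideanSpace.single 0 1)) y‖ₑ ^ 2 := by
  set W : EuclideanSpace ℝ (Fin 3) → ℝ := fun z =>
    fderiv ℝ (fun z' => fderiv ℝ S z' (EuclideanSpace.single 0 1)) z (EuclideanSpace.single 0 1)
    with hW
  have hS1 : ContDiff ℝ ((⊤ : ℕ∞) + 1 : ℕ∞) S := by simpa using hS
  have hdS : ContDiff ℝ (⊤ : ℕ∞) fun z' => fderiv ℝ S z' (EuclideanSpace.single 0 1) :=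
    contDiff_fderiv_apply_const_succ (n := (⊤ : ℕ∞)) hS1 _
  have hdS1 : ContDiff ℝ ((⊤ : ℕ∞) + 1 : ℕ∞) fun z' => fderiv ℝ S z' (EuclideanSpace.single 0 1) := by
    simpa using hdS
  have hW' : ContDiff ℝ ∞ W := contDiff_fderiv_apply_const_succ (n := (⊤ : ℕ∞)) hdS1 _
  have hm : Measurable fun y => ‖iteratedFDeriv ℝ n W y‖ₑ :=
    (hW'.continuous_iteratedFDeriv (m := n)
      (by exact_mod_cast (le_top : (n : ℕ∞) ≤ ⊤))).enorm.measurable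
  calc ∫⁻ y, ‖iteratedFDeriv ℝ n (radDerivQuot S) y‖ₑ ^ 2
      ≤ ∫⁻ y, (∫⁻ τ in Ioo (0 : ℝ) 1, ‖iteratedFDeriv ℝ n W (scaleFst τ y)‖ₑ) ^ 2 :=
        lintegral_mono fun y => by
          gcongr
          exact enorm_iteratedFDeriv_radDerivQuot_le hS n y
    _ ≤ 4 * ∫⁻ y, ‖iteratedFDeriv ℝ n W y‖ₑ ^ 2 := lintegral_sq_rayAverageFst_le hm

/-- **`∫ ‖Dⁿ(radQuot S)‖² ≤ 4 ∫ ‖Dⁿ(∂₀∂₀S)‖²`** for `S ∈ C^∞`: the radial quotient is in every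
Sobolev class in which `∂₀∂₀S` is. [folklore] -/
theorem lintegral_sq_iteratedFDeriv_radQuot_le (hS : ContDiff ℝ ∞ S) (n : ℕ) :
    ∫⁻ x, ‖iteratedFDeriv ℝ n (radQuot S) x‖ₑ ^ 2 ≤
      4 * ∫⁻ y, ‖iteratedFDeriv ℝ n
        (fun z => fderiv ℝ (fun z' => fderiv ℝ S z' (EuclideanSpace.single 0 1)) z
          (EuclideanSpace.single 0 1)) y‖ₑ ^ 2 := by
  have hS2 : ContDiff ℝ ((⊤ : ℕ∞) + 1 + 1 : ℕ∞) S := by simpa using hS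
  have hq : ContDiff ℝ ∞ (radDerivQuot S) := contDiff_radDerivQuot (n := (⊤ : ℕ∞)) hS2
  have hm : Measurable fun y => ‖iteratedFDeriv ℝ n (radDerivQuot S) y‖ₑ :=
    (hq.continuous_iteratedFDeriv (m := n)
      (by exact_mod_cast (le_top : (n : ℕ∞) ≤ ⊤))).enorm.measurable
  calc ∫⁻ x, ‖iteratedFDeriv ℝ n (radQuot S) x‖ₑ ^ 2
      ≤ ∫⁻ x, (∫⁻ s in Ioo (0 : ℝ) 1,
          ENNReal.ofReal s * ‖iteratedFDeriv ℝ n (radDerivQuot S) (scaleH s x)‖ₑ) ^ 2 :=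
        lintegral_mono fun x => by
          gcongr
          exact enorm_iteratedFDeriv_radQuot_le hS n x
    _ ≤ ∫⁻ y, ‖iteratedFDeriv ℝ n (radDerivQuot S) y‖ₑ ^ 2 := lintegral_sq_rayAverageH_le hm
    _ ≤ _ := lintegral_sq_iteratedFDeriv_radDerivQuot_le hS n

/-- **Sup bounds**: if `‖Dⁿ(∂₀∂₀S)‖ ≤ B` everywhere then `‖Dⁿ(radDerivQuot S)‖ ≤ B` and
`‖Dⁿ(radQuot S)‖ ≤ B/2`. [folklore] -/
theorem norm_iteratedFDeriv_radQuot_le_of_bound (hS : ContDiff ℝ ∞ S) (n : ℕ) {B : ℝ}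
    (hB : ∀ y, ‖iteratedFDeriv ℝ n
        (fun z => fderiv ℝ (fun z' => fderiv ℝ S z' (EuclideanSpace.single 0 1)) z
          (EuclideanSpace.single 0 1)) y‖ ≤ B) (x : EuclideanSpace ℝ (Fin 3)) :
    ‖iteratedFDeriv ℝ n (radDerivQuot S) x‖ ≤ B ∧ ‖iteratedFDeriv ℝ n (radQuot S) x‖ ≤ B / 2 := by
  set W : EuclideanSpace ℝ (Fin 3) → ℝ := fun z =>
    fderiv ℝ (fun z' => fderiv ℝ S z' (EuclideanSpace.single 0 1)) z (EuclideanSpace.single 0 1)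
    with hW
  have hS1 : ContDiff ℝ ((⊤ : ℕ∞) + 1 : ℕ∞) S := by simpa using hS
  have hdS : ContDiff ℝ (⊤ : ℕ∞) fun z' => fderiv ℝ S z' (EuclideanSpace.single 0 1) :=
    contDiff_fderiv_apply_const_succ (n := (⊤ : ℕ∞)) hS1 _
  have hdS1 : ContDiff ℝ ((⊤ : ℕ∞) + 1 : ℕ∞) fun z' => fderiv ℝ S z' (EuclideanSpace.single 0 1) := by
    simpa using hdS
  have hW' : ContDiff ℝ ∞ W := contDiff_fderiv_apply_const_succ (n := (⊤ : ℕ∞)) hdS1 _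
  have hS2 : ContDiff ℝ ((⊤ : ℕ∞) + 1 + 1 : ℕ∞) S := by simpa using hS
  have hqc : ContDiff ℝ ∞ (radDerivQuot S) := contDiff_radDerivQuot (n := (⊤ : ℕ∞)) hS2
  have hcW : ∀ y : EuclideanSpace ℝ (Fin 3),
      Continuous fun τ : ℝ => ‖iteratedFDeriv ℝ n W (scaleFst τ y)‖ := fun y =>
    ((hW'.continuous_iteratedFDeriv (m := n) (by exact_mod_cast (le_top : (n : ℕ∞) ≤ ⊤))).comp
      ((contDiff_scaleFst_uncurry (n := 0)).continuous.comp
        (continuous_const.prodMk continuous_id))).norm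
  have hcq : Continuous fun s : ℝ => s * ‖iteratedFDeriv ℝ n (radDerivQuot S) (scaleH s x)‖ :=
    continuous_id.mul ((hqc.continuous_iteratedFDeriv (m := n)
      (by exact_mod_cast (le_top : (n : ℕ∞) ≤ ⊤))).comp ((contDiff_scaleH_uncurry (n := 0)).continuous.comp
        (continuous_const.prodMk continuous_id))).norm
  have hq : ∀ y, ‖iteratedFDeriv ℝ n (radDerivQuot S) y‖ ≤ B := by
    intro y
    refine (norm_iteratedFDeriv_radDerivQuot_le hS n y).trans ?_
    have h := intervalIntegral.integral_mono_on (μ := volume) zero_le_one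
      ((hcW y).intervalIntegrable 0 1) (intervalIntegrable_const (c := B))
      (fun τ _ => hB (scaleFst τ y))
    simpa using h
  refine ⟨hq x, (norm_iteratedFDeriv_radQuot_le hS n x).trans ?_⟩
  have h := intervalIntegral.integral_mono_on (μ := volume) (g := fun s => s * B) zero_le_one
    (hcq.intervalIntegrable 0 1) ((continuous_id.mul continuous_const).intervalIntegrable 0 1)
    (fun s hs => mul_le_mul_of_nonneg_left (hq (scaleH s x)) hs.1)
  rw [intervalIntegral.integral_mul_const, integral_id] at h
  refine h.trans (le_of_eq ?_)
  ring

end RadialQuotients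

end Literature.Analysis.FluidPDE

end
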